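import Literature.NumberTheory.EllipticCurves.FormalGroupChartUniquenessProofs
import HarnessLib

/-!
# Vélu's `2`-isogeny with a `2`-torsion kernel ON THE FORMAL GROUP (any commutative ring): the isogeny parameter
# `τ = ψ*z'` and the `x`-relation `x'(τ) = x + t/(x − e)` as identities of power series — step S4 of the discharge
# plan for the PRINT stub `stub_sigmaSqTwo` of crux C3′ (route-independent)

Cell `bsd-f1-sign2`, WIDTH-5 attach seat `bsd-line-att-p3` g8 (`--supports stmt-BirchSwinnertonDyer-23008`; plan
`Cruxes/BSDOfMainConjectureRankOneAtTwo/SIGMASQ-AT-TWO-att-p3.md`). THEOREMS ONLY, over an ARBITRARY commutative ring `R` (so they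
apply verbatim to the universal ordinary `a₁`-chart `R̂₂`). BSD is not proved by any of this. Companion of `…SigmaSqTwoVelu.lean`
(the affine identities).

With `X = z²x(z)` (`formalXMulSq`), `Q = (e, f)` a `2`-torsion point of `V` (`2f + a₁e + a₃ = 0`), `t = 3e² + 2a₂e + a₄ − a₁f`, put
`A = X − ez²` (`= z²(x − e)`), `M = XA + tz⁴` (`= z⁴(x − e)x'`), `Dn = XA² + tz⁴(a₁zA − X − fz³)` (`= −z⁶(x − e)²y'`),
where `(x', y') = ψ(x(z), y(z))` is Vélu's image point (`x' = x + t/(x − e)`, `y' = y − t(a₁(x − e) + y − f)/(x − e)²`, `y = −X/z³`).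
Then `τ := −x'/y' = z·A·M/Dn` and `τ²x' = A·M³/Dn²` (`Dn(0) = 1`, so `Dn` is a unit of `R⟦z⟧`).

* `velu_two_formal_key` — **the cleared Weierstrass equation of `ψ` of the formal point on Vélu's curve `V'`**
  (`A₄ = a₄ − 5t`, `A₆ = a₆ − b₂t − 7et`): `Dn² = AM³ + a₁zAM·Dn + a₂z²A²M² + a₃z³A²·Dn + A₄z⁴A³M + A₆z⁶A⁴` — an identity in
  `R⟦z⟧` modulo the cleared equation of the formal point (`formalXMulSq_sq_eq`) and the relations of `(e, f, t)`; certified by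
  `linear_combination` with an integral certificate found by elimination (`t`, `a₃`, `a₆`, then division by the cubic in `X`).
* `velu_two_formalXMulSq_subst` — hence, by the tree's uniqueness of the formal chart (`formalXMulSq_subst_eq_of_sq_eq`, AEC IV.1.1):
  **`X_{V'}(τ) = A·M³·u²`** for `τ = z·A·M·u`, `u = Dn⁻¹` — the `x`-coordinate of `V'` read through the isogeny parameter;
* `velu_two_x_relation` — **`X_{V'}(τ)·z²A = τ²·M`**, i.e. `x'(τ) = (XA + tz⁴)/(z²A) = x + t/(x − e)`: the pole-cleared `x`-relation that the
  squared `2`-isogeny functional equation (`…SigmaSqTwoIsogenyFE.lean`, hypothesis `hx` with `π = 1`, `r₀ = 0` for Vélu's own model)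
  consumes; the Frobenius-compatible model at `p = 2` is obtained from Vélu's by `[u = 2; r, ½, −r/2]` (plan S3), transporting `τ` by
  the tree's `formalVariableChange`.

## Sources
* J. Vélu, C. R. Acad. Sci. Paris 273 (1971) 238–241. [cite: SilvermanAEC2009, III.4 Example 4.5 and Exercise 3.35]
* J. H. Silverman, *AEC* 2nd ed., IV.1 Prop. 1.1 (uniqueness of the formal chart). [cite: SilvermanAEC2009, IV.1.1]
* C. Blakestad, D. Grant, J. Number Theory 249 (2023), Prop. 7 (c), Lemma 12 (the parameter `t_p = −x_p/y_p` of the isogeny).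
  [cite: BlakestadGrant2023, Prop. 7]
-/

noncomputable section

set_option linter.dupNamespace false
set_option autoImplicit false

open scoped Classical
open PowerSeries WeierstrassCurve Literature.NumberTheory.EllipticCurves

namespace Summit.BirchSwinnertonDyer.BirchSwinnertonDyer.Theorems.AlignedTransportAtTwoSigmaSqTwo

variable {R : Type*} [CommRing R] (V : WeierstrassCurve R)

/-- **Vélu's `2`-isogeny on the formal point, cleared: `Dn² = AM³ + a₁zAM·Dn + a₂z²A²M² + a₃z³A²·Dn + A₄z⁴A³M + A₆z⁶A⁴`**
(notation of the module docstring; `A₄ = a₄ − 5t`, `A₆ = a₆ − b₂t − 7et`). [cite: SilvermanAEC2009, III.4 and IV.1.1] -/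
theorem velu_two_formal_key {e f t : R}
    (hQ : f ^ 2 + V.a₁ * e * f + V.a₃ * f = e ^ 3 + V.a₂ * e ^ 2 + V.a₄ * e + V.a₆)
    (h2 : 2 * f + V.a₁ * e + V.a₃ = 0) (ht : t = 3 * e ^ 2 + 2 * V.a₂ * e + V.a₄ - V.a₁ * f)
    (A M Dn : R⟦X⟧) (hA : A = V.formalXMulSq - C e * X ^ 2) (hM : M = V.formalXMulSq * A + C t * X ^ 4)
    (hDn : Dn = V.formalXMulSq * A ^ 2 + C t * X ^ 4 * (C V.a₁ * X * A - V.formalXMulSq - C f * X ^ 3)) :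
    Dn ^ 2 = A * M ^ 3 + C V.a₁ * X * A * M * Dn + C V.a₂ * X ^ 2 * A ^ 2 * M ^ 2 + C V.a₃ * X ^ 3 * A ^ 2 * Dn +
      (C V.a₄ - 5 * C t) * X ^ 4 * A ^ 3 * M + (C V.a₆ - (C V.a₁ ^ 2 + 4 * C V.a₂) * C t - 7 * C e * C t) * X ^ 6 * A ^ 4 := by
  subst hA hM hDn
  set Xs := V.formalXMulSq with hXsdef
  have hXs : Xs ^ 2 = Xs ^ 3 + C V.a₁ * X * Xs ^ 2 + C V.a₂ * X ^ 2 * Xs ^ 2 + C V.a₃ * X ^ 3 * Xs +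
      C V.a₄ * X ^ 4 * Xs + C V.a₆ * X ^ 6 := V.formalXMulSq_sq_eq
  have htC : (C t : R⟦X⟧) = 3 * C e ^ 2 + 2 * C V.a₂ * C e + C V.a₄ - C V.a₁ * C f := by
    have := congrArg (C (R := R)) ht
    simpa only [map_add, map_sub, map_mul, map_pow, map_ofNat] using this
  have h2C : 2 * (C f : R⟦X⟧) + C V.a₁ * C e + C V.a₃ = 0 := by
    have := congrArg (C (R := R)) h2
    simpa only [map_add, map_mul, map_ofNat, map_zero] using this
  have hQC : (C f : R⟦X⟧) ^ 2 + C V.a₁ * C e * C f + C V.a₃ * C f = C e ^ 3 + C V.a₂ * C e ^ 2 + C V.a₄ * C e + C V.a₆ := by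
    have := congrArg (C (R := R)) hQ
    simpa only [map_add, map_mul, map_pow] using this
  linear_combination ((2 : R⟦X⟧) * Xs ^ 5 * X ^ 4 + (-4 : R⟦X⟧) * Xs ^ 4 * X ^ 6 * C e + (2 : R⟦X⟧) * Xs ^ 4 * X ^ 6 * C V.a₂ + (2 : R⟦X⟧) * Xs ^ 4 * X ^ 5 * C V.a₁ + (-2 : R⟦X⟧) * Xs ^ 4 * X ^ 4 + -(Xs ^ 3 * X ^ 8 * (C e) ^ 2) + -(Xs ^ 3 * X ^ 8 * C e * (C V.a₁) ^ 2) + (-6 : R⟦X⟧) * Xs ^ 3 * X ^ 8 * C e * C V.a₂ + -(Xs ^ 3 * X ^ 8 * C f * C V.a₁) + (2 : R⟦X⟧) * Xs ^ 3 * X ^ 8 * C t + -(Xs ^ 3 * X ^ 8 * C V.a₁ * C V.a₃) + Xs ^ 3 * X ^ 8 * C V.a₄ + (-5 : R⟦X⟧) * Xs ^ 3 * X ^ 7 * C e * C V.a₁ + (-2 : R⟦X⟧) * Xs ^ 3 * X ^ 7 * C f + Xs ^ 3 * X ^ 7 * C V.a₃ + (4 : R⟦X⟧) * Xs ^ 3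 * X ^ 6 * C e + (-2 : R⟦X⟧) * Xs ^ 2 * X ^ 10 * (C e) ^ 3 + (3 : R⟦X⟧) * Xs ^ 2 * X ^ 10 * (C e) ^ 2 * (C V.a₁) ^ 2 + (-3 : R⟦X⟧) * Xs ^ 2 * X ^ 10 * (C e) ^ 2 * C V.a₂ + (7 : R⟦X⟧) * Xs ^ 2 * X ^ 10 * C e * C f * C V.a₁ + (-9 : R⟦X⟧) * Xs ^ 2 * X ^ 10 * C e * C t + (3 : R⟦X⟧) * Xs ^ 2 * X ^ 10 * C e * C V.a₁ * C V.a₃ + (-2 : R⟦X⟧) * Xs ^ 2 * X ^ 10 * C e * (C V.a₂) ^ 2 + (-6 : R⟦X⟧) * Xs ^ 2 * X ^ 10 * C e * C V.a₄ + Xs ^ 2 * X ^ 10 * C f * C V.a₁ * C V.a₂ + Xs ^ 2 * X ^ 10 * C f * C V.a₃ + -(Xs ^ 2 * X ^ 10 * C t * C V.a₂) + -(Xs ^ 2 * X ^ 10 * C V.a₂ * C V.a₄) + Xs ^ 2 * X ^ 9 * (C e) ^ 2 * C V.a₁ + (4 : R⟦X⟧) * Xs ^ 2 * X ^ 9 *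 C e * C f + (-2 : R⟦X⟧) * Xs ^ 2 * X ^ 9 * C e * C V.a₁ * C V.a₂ + (-2 : R⟦X⟧) * Xs ^ 2 * X ^ 9 * C e * C V.a₃ + Xs ^ 2 * X ^ 9 * C f * (C V.a₁) ^ 2 + -(Xs ^ 2 * X ^ 9 * C t * C V.a₁) + -(Xs ^ 2 * X ^ 9 * C V.a₁ * C V.a₄) + Xs ^ 2 * X ^ 8 * (C e) ^ 2 + (2 : R⟦X⟧) * Xs ^ 2 * X ^ 8 * C e * C V.a₂ + -(Xs ^ 2 * X ^ 8 * C f * C V.a₁) + Xs ^ 2 * X ^ 8 * C t + Xs ^ 2 * X ^ 8 * C V.a₄ + (4 : R⟦X⟧) * Xs * X ^ 12 * (C e) ^ 4 + (-3 : R⟦X⟧) * Xs * X ^ 12 * (C e) ^ 3 * (C V.a₁) ^ 2 + (4 : R⟦X⟧) * Xs * X ^ 12 * (C e) ^ 3 * C V.a₂ + (-8 : R⟦X⟧) * Xs * X ^ 12 * (C e) ^ 2 * C f * C V.a₁ + (9 : R⟦X⟧) * Xs * X ^ 12 * (C e) ^ 2 * C t + (-3 : R⟦X⟧) * Xs * X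 ^ 12 * (C e) ^ 2 * C V.a₁ * C V.a₃ + (3 : R⟦X⟧) * Xs * X ^ 12 * (C e) ^ 2 * C V.a₄ + (-2 : R⟦X⟧) * Xs * X ^ 12 * C e * C f * C V.a₃ + (-2 : R⟦X⟧) * Xs * X ^ 12 * C e * C V.a₂ * C V.a₄ + Xs * X ^ 12 * C f * C V.a₁ * C V.a₄ + -(Xs * X ^ 12 * (C t) ^ 2) + -(Xs * X ^ 12 * C t * C V.a₄) + -(Xs * X ^ 12 * (C V.a₄) ^ 2) + (2 : R⟦X⟧) * Xs * X ^ 11 * (C e) ^ 3 * C V.a₁ + (4 : R⟦X⟧) * Xs * X ^ 11 * (C e) ^ 2 * C f + (2 : R⟦X⟧) * Xs * X ^ 11 * (C e) ^ 2 * C V.a₁ * C V.a₂ + Xs * X ^ 11 * (C e) ^ 2 * C V.a₃ + -(Xs * X ^ 11 * C e * C f * (C V.a₁) ^ 2) + (4 : R⟦X⟧) * Xs * X ^ 11 * C e * C f * C V.a₂ + Xs * X ^ 11 * C e * C t * C V.a₁ + Xs * X ^ 11 * C e * C V.a₁ * C V.a₄ + (-2 : R⟦X⟧) * Xs * X ^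 11 * (C f) ^ 2 * C V.a₁ + (2 : R⟦X⟧) * Xs * X ^ 11 * C f * C t + (2 : R⟦X⟧) * Xs * X ^ 11 * C f * C V.a₄ + X ^ 14 * (C e) ^ 5 + X ^ 14 * (C e) ^ 4 * (C V.a₁) ^ 2 + (3 : R⟦X⟧) * X ^ 14 * (C e) ^ 4 * C V.a₂ + (2 : R⟦X⟧) * X ^ 14 * (C e) ^ 3 * C f * C V.a₁ + (-2 : R⟦X⟧) * X ^ 14 * (C e) ^ 3 * C t + X ^ 14 * (C e) ^ 3 * C V.a₁ * C V.a₃ + (2 : R⟦X⟧) * X ^ 14 * (C e) ^ 3 * (C V.a₂) ^ 2 + (2 : R⟦X⟧) * X ^ 14 * (C e) ^ 3 * C V.a₄ + (3 : R⟦X⟧) * X ^ 14 * (C e) ^ 2 * (C f) ^ 2 + -(X ^ 14 * (C e) ^ 2 * C f * C V.a₁ * C V.a₂) + X ^ 14 * (C e) ^ 2 * C f * C V.a₃ + X ^ 14 * (C e) ^ 2 * C t * C V.a₂ + (3 : R⟦X⟧) * X ^ 14 * (C e) ^ 2 * C V.a₂ * C V.a₄ + (2 : R⟦X⟧) * X ^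 14 * C e * (C f) ^ 2 * C V.a₂ + -(X ^ 14 * C e * C f * C V.a₁ * C V.a₄) + X ^ 14 * C e * (C t) ^ 2 + X ^ 14 * C e * C t * C V.a₄ + X ^ 14 * C e * (C V.a₄) ^ 2 + -(X ^ 14 * (C f) ^ 3 * C V.a₁) + X ^ 14 * (C f) ^ 2 * C t + X ^ 14 * (C f) ^ 2 * C V.a₄) * htC + ((-3 : R⟦X⟧) * Xs ^ 3 * X ^ 8 * (C e) ^ 2 * C V.a₁ + (-2 : R⟦X⟧) * Xs ^ 3 * X ^ 8 * C e * C V.a₁ * C V.a₂ + Xs ^ 3 * X ^ 8 * C f * (C V.a₁) ^ 2 + -(Xs ^ 3 * X ^ 8 * C V.a₁ * C V.a₄) + (-3 : R⟦X⟧) * Xs ^ 3 * X ^ 7 * (C e) ^ 2 + (-2 : R⟦X⟧) * Xs ^ 3 * X ^ 7 * C e * C V.a₂ + Xs ^ 3 * X ^ 7 * C f * C V.a₁ + -(Xs ^ 3 * X ^ 7 * C V.a₄) + (9 : R⟦X⟧) * Xs ^ 2 * X ^ 10 * (C e) ^ 3 * C V.a₁ + (-3 : R⟦X⟧) * Xs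 ^ 2 * X ^ 10 * (C e) ^ 2 * C f + (6 : R⟦X⟧) * Xs ^ 2 * X ^ 10 * (C e) ^ 2 * C V.a₁ * C V.a₂ + (-3 : R⟦X⟧) * Xs ^ 2 * X ^ 10 * C e * C f * (C V.a₁) ^ 2 + (-2 : R⟦X⟧) * Xs ^ 2 * X ^ 10 * C e * C f * C V.a₂ + (3 : R⟦X⟧) * Xs ^ 2 * X ^ 10 * C e * C V.a₁ * C V.a₄ + Xs ^ 2 * X ^ 10 * (C f) ^ 2 * C V.a₁ + -(Xs ^ 2 * X ^ 10 * C f * C V.a₄) + (6 : R⟦X⟧) * Xs ^ 2 * X ^ 9 * (C e) ^ 3 + (4 : R⟦X⟧) * Xs ^ 2 * X ^ 9 * (C e) ^ 2 * C V.a₂ + (-2 : R⟦X⟧) * Xs ^ 2 * X ^ 9 * C e * C f * C V.a₁ + (2 : R⟦X⟧) * Xs ^ 2 * X ^ 9 * C e * C V.a₄ + (-9 : R⟦X⟧) * Xs * X ^ 12 * (C e) ^ 4 * C V.a₁ + (6 : R⟦X⟧) * Xs * X ^ 12 * (C e) ^ 3 * C f + (-6 : R⟦X⟧) * Xs * X ^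 12 * (C e) ^ 3 * C V.a₁ * C V.a₂ + (3 : R⟦X⟧) * Xs * X ^ 12 * (C e) ^ 2 * C f * (C V.a₁) ^ 2 + (4 : R⟦X⟧) * Xs * X ^ 12 * (C e) ^ 2 * C f * C V.a₂ + (-3 : R⟦X⟧) * Xs * X ^ 12 * (C e) ^ 2 * C V.a₁ * C V.a₄ + (-2 : R⟦X⟧) * Xs * X ^ 12 * C e * (C f) ^ 2 * C V.a₁ + (2 : R⟦X⟧) * Xs * X ^ 12 * C e * C f * C V.a₄ + (6 : R⟦X⟧) * Xs * X ^ 11 * (C e) ^ 4 + (10 : R⟦X⟧) * Xs * X ^ 11 * (C e) ^ 3 * C V.a₂ + (-5 : R⟦X⟧) * Xs * X ^ 11 * (C e) ^ 2 * C f * C V.a₁ + (4 : R⟦X⟧) * Xs * X ^ 11 * (C e) ^ 2 * (C V.a₂) ^ 2 + (5 : R⟦X⟧) * Xs * X ^ 11 * (C e) ^ 2 * C V.a₄ + (-4 : R⟦X⟧) * Xs * X ^ 11 * C e * C f * C V.a₁ * C V.a₂ + (4 : R⟦X⟧) * Xs * X ^ 11 * C e * C V.a₂ * C V.a₄ + Xs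 * X ^ 11 * (C f) ^ 2 * (C V.a₁) ^ 2 + (-2 : R⟦X⟧) * Xs * X ^ 11 * C f * C V.a₁ * C V.a₄ + Xs * X ^ 11 * (C V.a₄) ^ 2 + (3 : R⟦X⟧) * X ^ 14 * (C e) ^ 5 * C V.a₁ + (6 : R⟦X⟧) * X ^ 14 * (C e) ^ 4 * C f + (2 : R⟦X⟧) * X ^ 14 * (C e) ^ 4 * C V.a₁ * C V.a₂ + -(X ^ 14 * (C e) ^ 3 * C f * (C V.a₁) ^ 2) + (10 : R⟦X⟧) * X ^ 14 * (C e) ^ 3 * C f * C V.a₂ + X ^ 14 * (C e) ^ 3 * C V.a₁ * C V.a₄ + (-5 : R⟦X⟧) * X ^ 14 * (C e) ^ 2 * (C f) ^ 2 * C V.a₁ + (4 : R⟦X⟧) * X ^ 14 * (C e) ^ 2 * C f * (C V.a₂) ^ 2 + (5 : R⟦X⟧) * X ^ 14 * (C e) ^ 2 * C f * C V.a₄ + (-4 : R⟦X⟧) * X ^ 14 * C e * (C f) ^ 2 * C V.a₁ * C V.a₂ + (4 : R⟦X⟧) * X ^ 14 * C e * C f * C V.a₂ * C V.a₄ + X ^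 14 * (C f) ^ 3 * (C V.a₁) ^ 2 + (-2 : R⟦X⟧) * X ^ 14 * (C f) ^ 2 * C V.a₁ * C V.a₄ + X ^ 14 * C f * (C V.a₄) ^ 2) * h2C + ((6 : R⟦X⟧) * Xs ^ 2 * X ^ 10 * (C e) ^ 2 + (4 : R⟦X⟧) * Xs ^ 2 * X ^ 10 * C e * C V.a₂ + (-2 : R⟦X⟧) * Xs ^ 2 * X ^ 10 * C f * C V.a₁ + (2 : R⟦X⟧) * Xs ^ 2 * X ^ 10 * C V.a₄ + (-12 : R⟦X⟧) * Xs * X ^ 12 * (C e) ^ 3 + (-8 : R⟦X⟧) * Xs * X ^ 12 * (C e) ^ 2 * C V.a₂ + (4 : R⟦X⟧) * Xs * X ^ 12 * C e * C f * C V.a₁ + (-4 : R⟦X⟧) * Xs * X ^ 12 * C e * C V.a₄ + (-3 : R⟦X⟧) * X ^ 14 * (C e) ^ 4 + (-8 : R⟦X⟧) * X ^ 14 * (C e) ^ 3 * C V.a₂ + (4 : R⟦X⟧) * X ^ 14 * (C e) ^ 2 * C f * C V.a₁ + (-4 : R⟦X⟧) * X ^ 14 * (C e) ^ 2 * (C V.a₂)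 ^ 2 + (-4 : R⟦X⟧) * X ^ 14 * (C e) ^ 2 * C V.a₄ + (4 : R⟦X⟧) * X ^ 14 * C e * C f * C V.a₁ * C V.a₂ + (-4 : R⟦X⟧) * X ^ 14 * C e * C V.a₂ * C V.a₄ + -(X ^ 14 * (C f) ^ 2 * (C V.a₁) ^ 2) + (2 : R⟦X⟧) * X ^ 14 * C f * C V.a₁ * C V.a₄ + -(X ^ 14 * (C V.a₄) ^ 2)) * hQC + (Xs ^ 4 + (-4 : R⟦X⟧) * Xs ^ 3 * X ^ 2 * C e + (-4 : R⟦X⟧) * Xs ^ 2 * X ^ 4 * C e * C V.a₂ + (2 : R⟦X⟧) * Xs ^ 2 * X ^ 4 * C f * C V.a₁ + (-2 : R⟦X⟧) * Xs ^ 2 * X ^ 4 * C V.a₄ + (8 : R⟦X⟧) * Xs * X ^ 6 * (C e) ^ 3 + (8 : R⟦X⟧) * Xs * X ^ 6 * (C e) ^ 2 * C V.a₂ + (-4 : R⟦X⟧) * Xs * X ^ 6 * C e * C f * C V.a₁ + (4 : R⟦X⟧) * Xs * X ^ 6 * C e * C V.a₄ + (4 : R⟦X⟧) * X ^ 8 *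 (C e) ^ 4 + (8 : R⟦X⟧) * X ^ 8 * (C e) ^ 3 * C V.a₂ + (-4 : R⟦X⟧) * X ^ 8 * (C e) ^ 2 * C f * C V.a₁ + (4 : R⟦X⟧) * X ^ 8 * (C e) ^ 2 * (C V.a₂) ^ 2 + (4 : R⟦X⟧) * X ^ 8 * (C e) ^ 2 * C V.a₄ + (-4 : R⟦X⟧) * X ^ 8 * C e * C f * C V.a₁ * C V.a₂ + (4 : R⟦X⟧) * X ^ 8 * C e * C V.a₂ * C V.a₄ + X ^ 8 * (C f) ^ 2 * (C V.a₁) ^ 2 + (-2 : R⟦X⟧) * X ^ 8 * C f * C V.a₁ * C V.a₄ + X ^ 8 * (C V.a₄) ^ 2) * hXs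

/-- **The `x`-coordinate of Vélu's curve read through the isogeny parameter**: with `u·Dn = 1`, `τ = z·A·M·u` (`= −x'/y'`) and
`V'` any Weierstrass equation with Vélu's coefficients, `X_{V'}(τ) = A·M³·u²` (`= τ²·x'`) — by uniqueness of the formal chart.
[cite: SilvermanAEC2009, IV.1.1] [cite: BlakestadGrant2023, Prop. 7] -/
theorem velu_two_formalXMulSq_subst {e f t : R}
    (hQ : f ^ 2 + V.a₁ * e * f + V.a₃ * f = e ^ 3 + V.a₂ * e ^ 2 + V.a₄ * e + V.a₆)
    (h2 : 2 * f + V.a₁ * e + V.a₃ = 0) (ht : t = 3 * e ^ 2 + 2 * V.a₂ * e + V.a₄ - V.a₁ * f)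
    {A M Dn u : R⟦X⟧} (hA : A = V.formalXMulSq - C e * X ^ 2) (hM : M = V.formalXMulSq * A + C t * X ^ 4)
    (hDn : Dn = V.formalXMulSq * A ^ 2 + C t * X ^ 4 * (C V.a₁ * X * A - V.formalXMulSq - C f * X ^ 3))
    (hu : Dn * u = 1) (V' : WeierstrassCurve R) (h1' : V'.a₁ = V.a₁) (h2' : V'.a₂ = V.a₂) (h3' : V'.a₃ = V.a₃)
    (h4' : V'.a₄ = V.a₄ - 5 * t) (h6' : V'.a₆ = V.a₆ - V.b₂ * t - 7 * e * t) :
    V'.formalXMulSq.subst (X * A * M * u) = A * M ^ 3 * u ^ 2 := by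
  have key := velu_two_formal_key V hQ h2 ht A M Dn hA hM hDn
  have hA0 : constantCoeff A = 1 := by
    rw [hA, map_sub, map_mul, map_pow, constantCoeff_X, constantCoeff_formalXMulSq]; ring
  have hM0 : constantCoeff M = 1 := by
    rw [hM, map_add, map_mul, map_mul, map_pow, constantCoeff_X, constantCoeff_formalXMulSq, hA0]; ring
  have hDn0 : constantCoeff Dn = 1 := by
    rw [hDn, map_add, map_mul, map_mul, map_mul, map_pow, map_pow, constantCoeff_X, constantCoeff_formalXMulSq, hA0]
    ring
  have hu0 : constantCoeff u = 1 := by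
    have e1 := congrArg constantCoeff hu
    rw [map_mul, hDn0, one_mul, map_one] at e1
    exact e1
  have hτ0 : constantCoeff (X * A * M * u) = 0 := by
    rw [map_mul, map_mul, map_mul, constantCoeff_X]; ring
  have hP0 : constantCoeff (A * M ^ 3 * u ^ 2) = 1 := by
    rw [map_mul, map_mul, map_pow, map_pow, hA0, hM0, hu0]; ring
  refine V'.formalXMulSq_subst_eq_of_sq_eq hτ0 hP0 ?_
  rw [h1', h2', h3', h4', h6', WeierstrassCurve.b₂]
  simp only [map_sub, map_mul, map_add, map_pow, map_ofNat]
  set L₁ := C V.a₁ * X * A * M + C V.a₃ * X ^ 3 * A ^ 2 with hL₁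
  linear_combination (A ^ 2 * M ^ 6 * u ^ 6) * key + (-(A ^ 2 * M ^ 6 * u ^ 4 * (1 + u * Dn - u * L₁))) * hu

/-- **The `x`-relation of Vélu's `2`-isogeny on the formal group, pole-cleared: `X_{V'}(τ)·z²A = τ²·M`** (`x'(τ) = x + t/(x − e)`).
This is hypothesis `hx` of `X_sq_mul_sq_subst_eq_of_twoIsogeny` for Vélu's own model (`π = 1`, `r₀ = 0`):
`X_{V'}(τ)·z²(X − ez²) = τ²(X(X − ez²) + tz⁴)`. [cite: SilvermanAEC2009, III.4] [cite: BlakestadGrant2023, Prop. 7] -/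
theorem velu_two_x_relation {e f t : R}
    (hQ : f ^ 2 + V.a₁ * e * f + V.a₃ * f = e ^ 3 + V.a₂ * e ^ 2 + V.a₄ * e + V.a₆)
    (h2 : 2 * f + V.a₁ * e + V.a₃ = 0) (ht : t = 3 * e ^ 2 + 2 * V.a₂ * e + V.a₄ - V.a₁ * f)
    {A M Dn u : R⟦X⟧} (hA : A = V.formalXMulSq - C e * X ^ 2) (hM : M = V.formalXMulSq * A + C t * X ^ 4)
    (hDn : Dn = V.formalXMulSq * A ^ 2 + C t * X ^ 4 * (C V.a₁ * X * A - V.formalXMulSq - C f * X ^ 3))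
    (hu : Dn * u = 1) (V' : WeierstrassCurve R) (h1' : V'.a₁ = V.a₁) (h2' : V'.a₂ = V.a₂) (h3' : V'.a₃ = V.a₃)
    (h4' : V'.a₄ = V.a₄ - 5 * t) (h6' : V'.a₆ = V.a₆ - V.b₂ * t - 7 * e * t) :
    V'.formalXMulSq.subst (X * A * M * u) * (X ^ 2 * (V.formalXMulSq - C e * X ^ 2)) =
      (X * A * M * u) ^ 2 * (V.formalXMulSq * (V.formalXMulSq - C e * X ^ 2) + C t * X ^ 4) := by
  rw [velu_two_formalXMulSq_subst V hQ h2 ht hA hM hDn hu V' h1' h2' h3' h4' h6', ← hA]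
  have hM' : V.formalXMulSq * A + C t * X ^ 4 = M := hM.symm
  rw [hM']
  ring

end Summit.BirchSwinnertonDyer.BirchSwinnertonDyer.Theorems.AlignedTransportAtTwoSigmaSqTwo
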